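import Literature.Barriers.CriticalPhenomena.PlaquetteWalkHoleRootNoKissSeven
import Literature.Barriers.CriticalPhenomena.PlaquetteWalkHoleRootRowLaw
import HarnessLib

/-!
# Barrier catalogue (SAWScalingLimit): horizontal runs read backwards, and the excursion arc on the western ray («COLUMN LAW», tools for the frame)

`Z → ∞` limit model of the printed Yang–Baxter weights [GlazmanManolescu2019, §1, eq. (1)]; the «RECTANGLE COEFFICIENT» line of the venture lane «pcv-sawmu»
(b-engine-1 g26), tools for the FRAME of the cost-`7` vertical-end parents above/below the root row (DESIGN-next-g26 §4, F1–F4). §1 ★ the straight runs of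
`PlaquetteWalkStraightRuns` read BACKWARDS along a row (`YBWalk.run_back_west/east_of_straight`: an arc entering through `W`/`E` after `M` straight plaquettes
is preceded by the run through them). §2 ★★ `ΩG.exists_arc_west_rootRow_after_fh`: the parity law (#838: a wound excursion crosses the western ray behind the
hole root an odd number of times) in the form the chain calculus consumes — a wound class-`B2a` walk at a rhombus of the root column or east of it has an arc
OF ITS EXCURSION (index `≥ firstHitG`) in a plaquette `(x₀, w.2)` of the root row with `x₀ ≤ w.1 − 2`, using that plaquette's `S` side (the block inlined in
`PlaquetteWalkHoleRootNotTopRow`, now a lemma). [GlazmanManolescu2019 §1 Fig. 1, Lemma 2.1, Remark 2.2; Glazman2015WeightedSAW Lemma 3.1 (proof, pp. 6–7);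
CourantRobbins1958 Ch. V App. §2]
-/

noncomputable section

namespace Literature.Probability.RandomPlanarGeometry.SAW.YangBaxter

open Real
open Literature.Barriers.CriticalPhenomena.PlaquetteWalk

open private fc_fh fh_add_Mv three_le_Mv from Literature.Probability.RandomPlanarGeometry.YangBaxterSAWGeneralDomain

namespace YBWalk

variable {D : Set Face} {a z : MidEdge} (γ : YBWalk D a z)

/-! ## §1 Horizontal runs read backwards -/

/-- ★ **A RUN READ BACKWARDS, WEST ALONG A ROW OF STRAIGHT CELLS**: if the arc `j` enters through `W` and the `M ≤ j` plaquettes to the west carry only straight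
arcs, the arcs `j − 1, …, j − M` lie in them in order, each entering through `W`. [cite: GlazmanManolescu2019, §1, Fig. 1 (consecutive arcs lie in adjacent rhombi)] -/
theorem run_back_west_of_straight {j M : ℕ} (hj : j < γ.arcs.length) (hMj : M ≤ j) (hW : γ.sIn j = .W)
    (hcells : ∀ m : ℕ, 1 ≤ m → m ≤ M → ∀ i < γ.arcs.length, γ.fc i = ((γ.fc j).1 - m, (γ.fc j).2) → arcKind (γ.sIn i) (γ.sOut i) = .straight) :
    ∀ m : ℕ, m ≤ M → γ.fc (j - m) = ((γ.fc j).1 - m, (γ.fc j).2) ∧ γ.sIn (j - m) = .W := by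
  intro m
  induction m with
  | zero => intro _; exact ⟨by simp, hW⟩
  | succ m ih =>
    intro hm
    obtain ⟨hfc, hin⟩ := ih (by omega)
    obtain ⟨hfc', hout⟩ := γ.fc_pred_eq_of_sIn_W (i := j - m) (by omega) (by omega) hin
    rw [show j - m - 1 = j - (m + 1) by omega] at hfc' hout
    have hpos : γ.fc (j - (m + 1)) = ((γ.fc j).1 - ((m + 1 : ℕ) : ℤ), (γ.fc j).2) := by
      rw [hfc', hfc]; simp only; push_cast; ring_nf
    refine ⟨hpos, ?_⟩
    have hk := hcells (m + 1) (by omega) hm _ (by omega) hpos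
    have h2 := γ.sOut_of_straight (show j - (m + 1) < γ.arcs.length by omega) hk
    rw [hout] at h2
    revert h2; cases γ.sIn (j - (m + 1)) <;> decide

/-- ★ **A RUN READ BACKWARDS, EAST ALONG A ROW OF STRAIGHT CELLS** (mirror). [cite: GlazmanManolescu2019, §1, Fig. 1 (consecutive arcs lie in adjacent rhombi)] -/
theorem run_back_east_of_straight {j M : ℕ} (hj : j < γ.arcs.length) (hMj : M ≤ j) (hE : γ.sIn j = .E)
    (hcells : ∀ m : ℕ, 1 ≤ m → m ≤ M → ∀ i < γ.arcs.length, γ.fc i = ((γ.fc j).1 + m, (γ.fc j).2) → arcKind (γ.sIn i) (γ.sOut i) = .straight) :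
    ∀ m : ℕ, m ≤ M → γ.fc (j - m) = ((γ.fc j).1 + m, (γ.fc j).2) ∧ γ.sIn (j - m) = .E := by
  intro m
  induction m with
  | zero => intro _; exact ⟨by simp, hE⟩
  | succ m ih =>
    intro hm
    obtain ⟨hfc, hin⟩ := ih (by omega)
    obtain ⟨hfc', hout⟩ := γ.fc_pred_eq_of_sIn_E (i := j - m) (by omega) (by omega) hin
    rw [show j - m - 1 = j - (m + 1) by omega] at hfc' hout
    have hpos : γ.fc (j - (m + 1)) = ((γ.fc j).1 + ((m + 1 : ℕ) : ℤ), (γ.fc j).2) := by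
      rw [hfc', hfc]; simp only; push_cast; ring_nf
    refine ⟨hpos, ?_⟩
    have hk := hcells (m + 1) (by omega) hm _ (by omega) hpos
    have h2 := γ.sOut_of_straight (show j - (m + 1) < γ.arcs.length by omega) hk
    rw [hout] at h2
    revert h2; cases γ.sIn (j - (m + 1)) <;> decide

end YBWalk

namespace ΩG

open private side_jOut from Literature.Probability.RandomPlanarGeometry.YangBaxterSAWExcursionJordan
open private sIn_succ_of_sOut_N from Literature.Barriers.CriticalPhenomena.PlaquetteWalkHoleRootRowLaw

variable {D : Set Face} {w r : Face} {ω : ΩG D (w.side .W) r}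

/-! ## §2 The excursion arc on the western ray -/

/-- ★★ **A WOUND EXCURSION DRAWS AN ARC THROUGH THE `S` SIDE OF A ROOT-ROW PLAQUETTE WEST OF THE HOLE.** For a wound class-`B2a` walk from the hole root
`w.side W` (hole `(w.1 − 1, w.2)` absent) at a rhombus `r` of the root column or east of it, some arc of index `≥ firstHitG` lies in a plaquette `(x₀, w.2)`
with `x₀ ≤ w.1 − 2` and enters or leaves it through `S`: the excursion's exit mid-edge on the western ray (odd ray count, #838) is the `S` side of such a
plaquette, the arc before or after it lies there, and the return edge of `r` is not on the ray. [cite: GlazmanManolescu2019, Lemma 2.1 (statement, «in the form given in [Gl]»); §1, Fig. 1]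
[cite: Glazman2015WeightedSAW, Lemma 3.1 (proof, pp. 6–7)] [cite: CourantRobbins1958, Ch. V Appendix §2 (the even–odd rule)] -/
theorem exists_arc_west_rootRow_after_fh (hh : holeFaceW w ∉ D) (hr : RootedFace D (w.side .W) r) (h : ω.IsB2a)
    (hA : ω.AJ hr h (toC (midPt (w.side .W))) ≠ 0) (hcol : w.1 ≤ r.1) :
    ∃ i, ω.2.firstHitG ≤ i ∧ i < ω.2.arcs.length ∧ (ω.2.fc i).2 = w.2 ∧ (ω.2.fc i).1 ≤ w.1 - 2 ∧
      (ω.2.sIn i = .S ∨ ω.2.sOut i = .S) := by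
  set n := ω.2.arcs.length with hn
  have hMvn : ω.2.firstHitG + ω.Mv = n := fh_add_Mv h
  have hodd := (ω.AJ_root_ne_zero_iff_odd_rayCountAt (hr := hr) h (b := w) (τ := .W) rfl).1 hA
  obtain ⟨j, hj, m, he⟩ := ω.exists_exit_eq_rayMid_of_odd hr h hodd
  rw [rayMid_W_eq, side_jOut h hj] at he
  -- an arc at `(w.1 − 1 − m, w.2)` through its `S` side, with index `≥ firstHitG`
  obtain ⟨i', hi'F, hi'n, hfci', hSi'⟩ : ∃ i', ω.2.firstHitG ≤ i' ∧ i' < n ∧ ω.2.fc i' = (w.1 - 1 - m, w.2) ∧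
      (ω.2.sIn i' = .S ∨ ω.2.sOut i' = .S) := by
    have hi : ω.2.firstHitG + j < n := by omega
    obtain ⟨-, hout⟩ := ω.2.side_sIn_eq_nth hi
    rw [he] at hout
    rcases eq_of_side_eq_slant hout with ⟨hf1, hs1⟩ | ⟨hf1, hs1⟩
    · exact ⟨_, by omega, hi, hf1, Or.inr hs1⟩
    · by_cases hlast : ω.2.firstHitG + j + 1 < n
      · have hf2 := ω.2.fc_succ_eq_of_sOut_N hlast hs1
        rw [hf1] at hf2
        exact ⟨_, by omega, hlast, by rw [hf2]; exact Prod.ext rfl (by simp only; omega),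
          Or.inl (sIn_succ_of_sOut_N ω.2 hlast hs1)⟩
      · -- the crossing would be the return edge of `r`, which lies in column `r.1 ≥ w.1` or is vertical
        exfalso
        have hlen1 : ω.2.firstHitG + j + 1 = n := by omega
        have hz' : ω.2.nth n = r.side ω.1 := ω.2.nth_length
        rw [← hlen1, he] at hz'
        obtain ⟨r1, r2⟩ := r
        simp only at hcol
        generalize ht : ω.1 = t at hz'
        cases t <;> simp only [Face.side, MidEdge.slant.injEq, reduceCtorEq] at hz' <;> omega
  have hD' : ((w.1 - 1 - (m : ℤ), w.2) : Face) ∈ D := by rw [← hfci']; exact (YBWalk.arcFace_arcAt hi'n).2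
  have hm1 : 1 ≤ m := by
    by_contra hlt
    have e0 : m = 0 := by omega
    refine hh ?_
    have e : holeFaceW w = (w.1 - 1 - ((m : ℕ) : ℤ), w.2) := by rw [e0]; simp [holeFaceW]
    rw [e]; exact hD'
  exact ⟨i', hi'F, hi'n, by rw [hfci'], by rw [hfci']; show w.1 - 1 - (m : ℤ) ≤ w.1 - 2; omega, hSi'⟩

end ΩG

end Literature.Probability.RandomPlanarGeometry.SAW.YangBaxter
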